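import Summits.AtomisticToContinuum.HydrodynamicLimit.Theorems.BoxDissipativeWeakStrongRelativeEnergyStabilityDefs
import HarnessLib

/-!
# Crux `RelativeEnergyStability` (stmt-AtomisticToContinuum-17653), line `registered`, heart stub S-X — part 1:
# the route's closure statements K1 (`FluxClosure`) and K2 (`EntropyAdmissibility`) in the line's vocabulary

`FluxClosure` and `EntropyAdmissibility` (Theses/BoxDissipativeWeakStrong.lean) are stated with a chain of `let`s
(`K, Dn, Mm, En, Th, Zc, Pc` resp. `…, Fc, Sc`). This file records, once and for all, the two instances the
Březina–Feireisl argument consumes — K1 tested with the strong velocity `w := u`, K2 tested with the strong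
temperature `φ := θ` and the clamp `Z_{a,b}` — written over the Defs objects `RES.boxState` / `RES.boxKernel` /
`RES.cutEOS` (which are, definitionally, those `let`s). Pure bookkeeping: the proofs are `exact` after zeta-reduction.
-/

noncomputable section

namespace Summit.AtomisticToContinuum.HydrodynamicLimit.Theorems.RES

open MeasureTheory Filter Set
open Literature.MathematicalPhysics.KineticTheory Literature.Analysis.FluidPDE Literature.Analysis.FunctionSpaces
open Summit.AtomisticToContinuum.HydrodynamicLimit.Theses.BoxDissipativeWeakStrong
open scoped ENNReal Topology

/-- **K1 tested with the strong velocity.** Under `FluxClosure` and the EOS fact: band threshold `ηc`, then for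
every band, profiles, small `σ`, guarded classical solution, flow family with the `t = 0` LLN and kinetic window,
at every `τ < T` the pathwise momentum-balance defect of the box fields tested with `w := u`,
`[∫ m̂·u]₀^τ − ∫₀^τ∫ (m̂·∂ₜu + (m̂⊗m̂/ρ̂):∇u + p_cut(ρ̂,θ̂) div u)`, tends to `0` in `L¹(P_N)`. -/
theorem sx_fluxClosure_velocity (hFC : FluxClosure) (hEos : HsEosLowDensity) :
    ∃ ηc : ℝ, 0 < ηc ∧ ∀ η₁ : ℝ, 0 < η₁ → η₁ < ηc →
      ∀ (a₀ θ₀ : T3 → ℝ) (u₀ : T3 → V3), Continuous a₀ → Continuous θ₀ → Continuous u₀ →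
        (∀ x, 0 < a₀ x) → (∀ x, 0 < θ₀ x) →
        ∃ σ₀ : ℝ, 0 < σ₀ ∧ ∀ σ : ℝ, 0 < σ → σ < σ₀ →
          ∀ (T : ℝ) (ρ θ : ℝ → T3 → ℝ) (u : ℝ → T3 → V3), IsHardSphereEulerSolution σ T ρ u θ →
            (∀ t ∈ Ico 0 T, ∀ x, ρ t x * σ ^ 3 ≤ η₁ / 2) →
            ∀ Φ : (N : ℕ) → HardSphereFlow (Literature.Analysis.FluidPDE.Torus.geometry (Fin 3))
                (hsDiameter σ N) (N + 1),
              TendstoHydroFieldsAt (fun N => localGibbsLaw σ a₀ u₀ θ₀ N (Φ N)) Φ ρ u θ 0 →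
                ∀ ℓ : ℕ → ℝ, IsKineticWindow ℓ → ∀ τ ∈ Ico 0 T,
                  Tendsto (fun N : ℕ => ∫⁻ z, ENNReal.ofReal
                    (|(∫ x, inner ℝ (boxState (ℓ N) ((Φ N).flow τ z) x).2.1 (u τ x)) -
                      (∫ x, inner ℝ (boxState (ℓ N) ((Φ N).flow 0 z) x).2.1 (u 0 x)) -
                      ∫ t in Ioc 0 τ, ∫ x,
                        (inner ℝ (boxState (ℓ N) ((Φ N).flow t z) x).2.1
                            (Torus.timeDerivWithin (Ico 0 T) u t x) +
                          (∑ i, ∑ j, (boxState (ℓ N) ((Φ N).flow t z) x).2.1 i *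
                              (boxState (ℓ N) ((Φ N).flow t z) x).2.1 j /
                              (boxState (ℓ N) ((Φ N).flow t z) x).1 *
                            Torus.partialDeriv j (fun y => u t y i) x) +
                          (boxState (ℓ N) ((Φ N).flow t z) x).1 *
                              (2 / 3 * ((boxState (ℓ N) ((Φ N).flow t z) x).2.2 /
                                  (boxState (ℓ N) ((Φ N).flow t z) x).1 -
                                ‖(boxState (ℓ N) ((Φ N).flow t z) x).2.1‖ ^ 2 /
                                  (2 * (boxState (ℓ N) ((Φ N).flow t z) x).1 ^ 2))) *
                              cutCompressibility η₁ ((boxState (ℓ N) ((Φ N).flow t z) x).1 * σ ^ 3) *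
                            Torus.divergence (u t) x)|)
                    ∂(localGibbsLaw σ a₀ u₀ θ₀ N (Φ N))) atTop (𝓝 0) := by
  obtain ⟨ηc, hηc, H⟩ := hFC hEos
  refine ⟨ηc, hηc, fun η₁ hη₁ hη₁c a₀ θ₀ u₀ ha hθ hu hap hθp => ?_⟩
  obtain ⟨σ₀, hσ₀, G⟩ := H η₁ hη₁ hη₁c a₀ θ₀ u₀ ha hθ hu hap hθp
  refine ⟨σ₀, hσ₀, fun σ hσ hσlt T ρ θ u hsol hguard Φ h0 ℓ hℓ τ hτ => ?_⟩
  have G' := G σ hσ hσlt T ρ θ u hsol hguard Φ h0 ℓ hℓ.1 hℓ.2.1 hℓ.2.2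
  dsimp only at G'
  exact G' τ hτ u hsol.smooth_velocity

/-- **K2 tested with the strong temperature and the clamp `Z_{a,b}`.** Under `EntropyAdmissibility` and the EOS
fact: band threshold `ηc`, then for every band, profiles, small `σ`, guarded classical solution, flow family with the
`t = 0` LLN and kinetic window, at every `τ < T` and for all `a < b`, the positive part of
`∫₀^τ∫ (ρ̂ Z(ŝ) ∂ₜθ + Z(ŝ) m̂·∇θ) − [∫ ρ̂ Z(ŝ) θ]₀^τ` tends to `0` in `L¹(P_N)`. -/
theorem sx_entropyAdmissibility_temperature (hEA : EntropyAdmissibility) (hEos : HsEosLowDensity) :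
    ∃ ηc : ℝ, 0 < ηc ∧ ∀ η₁ : ℝ, 0 < η₁ → η₁ < ηc →
      ∀ (a₀ θ₀ : T3 → ℝ) (u₀ : T3 → V3), Continuous a₀ → Continuous θ₀ → Continuous u₀ →
        (∀ x, 0 < a₀ x) → (∀ x, 0 < θ₀ x) →
        ∃ σ₀ : ℝ, 0 < σ₀ ∧ ∀ σ : ℝ, 0 < σ → σ < σ₀ →
          ∀ (T : ℝ) (ρ θ : ℝ → T3 → ℝ) (u : ℝ → T3 → V3), IsHardSphereEulerSolution σ T ρ u θ →
            (∀ t ∈ Ico 0 T, ∀ x, ρ t x * σ ^ 3 ≤ η₁ / 2) →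
            ∀ Φ : (N : ℕ) → HardSphereFlow (Literature.Analysis.FluidPDE.Torus.geometry (Fin 3))
                (hsDiameter σ N) (N + 1),
              TendstoHydroFieldsAt (fun N => localGibbsLaw σ a₀ u₀ θ₀ N (Φ N)) Φ ρ u θ 0 →
                ∀ ℓ : ℕ → ℝ, IsKineticWindow ℓ → ∀ τ ∈ Ico 0 T, ∀ a b : ℝ, a < b →
                  Tendsto (fun N : ℕ => ∫⁻ z, ENNReal.ofReal
                    ((∫ t in Ioc 0 τ, ∫ x,
                        ((boxState (ℓ N) ((Φ N).flow t z) x).1 *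
                              max a (min ((cutEOS σ η₁).s (boxState (ℓ N) ((Φ N).flow t z) x).1
                                (2 / 3 * ((boxState (ℓ N) ((Φ N).flow t z) x).2.2 /
                                    (boxState (ℓ N) ((Φ N).flow t z) x).1 -
                                  ‖(boxState (ℓ N) ((Φ N).flow t z) x).2.1‖ ^ 2 /
                                    (2 * (boxState (ℓ N) ((Φ N).flow t z) x).1 ^ 2)))) b) *
                            Torus.timeDerivWithin (Ico 0 T) θ t x +
                          max a (min ((cutEOS σ η₁).s (boxState (ℓ N) ((Φ N).flow t z) x).1
                                (2 / 3 * ((boxState (ℓ N) ((Φ N).flow t z) x).2.2 /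
                                    (boxState (ℓ N) ((Φ N).flow t z) x).1 -
                                  ‖(boxState (ℓ N) ((Φ N).flow t z) x).2.1‖ ^ 2 /
                                    (2 * (boxState (ℓ N) ((Φ N).flow t z) x).1 ^ 2)))) b) *
                            inner ℝ (boxState (ℓ N) ((Φ N).flow t z) x).2.1 (Torus.gradient (θ t) x))) -
                      (∫ x, (boxState (ℓ N) ((Φ N).flow τ z) x).1 *
                          max a (min ((cutEOS σ η₁).s (boxState (ℓ N) ((Φ N).flow τ z) x).1
                            (2 / 3 * ((boxState (ℓ N) ((Φ N).flow τ z) x).2.2 /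
                                (boxState (ℓ N) ((Φ N).flow τ z) x).1 -
                              ‖(boxState (ℓ N) ((Φ N).flow τ z) x).2.1‖ ^ 2 /
                                (2 * (boxState (ℓ N) ((Φ N).flow τ z) x).1 ^ 2)))) b) * θ τ x) +
                      (∫ x, (boxState (ℓ N) ((Φ N).flow 0 z) x).1 *
                          max a (min ((cutEOS σ η₁).s (boxState (ℓ N) ((Φ N).flow 0 z) x).1
                            (2 / 3 * ((boxState (ℓ N) ((Φ N).flow 0 z) x).2.2 /
                                (boxState (ℓ N) ((Φ N).flow 0 z) x).1 -
                              ‖(boxState (ℓ N) ((Φ N).flow 0 z) x).2.1‖ ^ 2 /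
                                (2 * (boxState (ℓ N) ((Φ N).flow 0 z) x).1 ^ 2)))) b) * θ 0 x))
                    ∂(localGibbsLaw σ a₀ u₀ θ₀ N (Φ N))) atTop (𝓝 0) := by
  obtain ⟨ηc, hηc, H⟩ := hEA hEos
  refine ⟨ηc, hηc, fun η₁ hη₁ hη₁c a₀ θ₀ u₀ ha hθ hu hap hθp => ?_⟩
  obtain ⟨σ₀, hσ₀, G⟩ := H η₁ hη₁ hη₁c a₀ θ₀ u₀ ha hθ hu hap hθp
  refine ⟨σ₀, hσ₀, fun σ hσ hσlt T ρ θ u hsol hguard Φ h0 ℓ hℓ τ hτ a b hab => ?_⟩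
  have G' := G σ hσ hσlt T ρ θ u hsol hguard Φ h0 ℓ hℓ.1 hℓ.2.1 hℓ.2.2
  dsimp only at G'
  exact G' τ hτ a b hab θ hsol.smooth_temperature
    (fun t ht x => (hsol.temperature_pos t ⟨ht.1, ht.2.trans_lt hτ.2⟩ x).le)

end Summit.AtomisticToContinuum.HydrodynamicLimit.Theorems.RES

end
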